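/-
Copyright (c) 2026. All rights reserved.
Released under Apache 2.0 license as described in the file LICENSE.
-/
import Literature.AlgebraicGeometry.ComplexMultiplication.CyclotomicDegenerateCMTypesTwoOddPrimes
import HarnessLib

/-!
# Hazama's examples in `ℚ(ζ₃₁)` (`2·3·5 + 1 = 31`): a `3`-dominated and a `5`-dominated primitive CM type, their
# ranks `12` and `14`, the exceptional Hodge classes of their abelian `15`-folds — and the lists as printed

Layer `Literature/AlgebraicGeometry/ComplexMultiplication`; the worked instance `ℓ = 31`, `p = 3`, `q = 5` of
`CyclotomicDegenerateCMTypesTwoOddPrimes` (Hazama 2003, Thm. 4.8 dressed on `ℚ(ζ_ℓ)`).  Everything is PROVED: the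
definitions are four explicit residue sets and two explicit units of `ℤ/31`; the finite combinatorics (CM condition,
row and column counts, stabilisers) is `decide`d on `ℤ/31` and transported by the dictionary of the parent file; no
named fact, no `sorry`.

## The print

F. Hazama, *Hodge cycles on abelian varieties with complex multiplication by cyclic CM-fields*, J. Math. Sci. Univ.
Tokyo **10** (2003) [Hazama2003CyclicCM], §6 "Examples" (held text `paper:w2141840783`, p. 597–598):

> "Let `K_n = ℚ(ζ_n)` … When `n = 31`, we have `G₃₁ ≅ (ℤ/31ℤ)^*`. We use the primitive root `3 ∈ (ℤ/31ℤ)^*` to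
> specify an isomorphism `G₃₁ ≅ ℤ/30ℤ`. The matrix `(a_{ij}) ∈ M(5, 3)` defined by `a_{i1} = 1` (`1 ≤ i ≤ 5`),
> `a_{ij} = 0` (`j ≥ 2`), satisfies the condition specified in Proposition 4.3 when `p = 3`, `q = 5`. … this matrix
> corresponds to `(e₀, …, e₁₄)` with `e_i = 1` (`0 ≤ i ≤ 4`), `−1` (`5 ≤ i ≤ 14`). Furthermore this vector
> corresponds by (4.3) [`e_a = (−1)^a ε_a`] to `(ε₀, …, ε₁₄)` with `ε_i = (−1)^i` (`0 ≤ i ≤ 4`), `(−1)^{i+1}`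
> (`5 ≤ i ≤ 14`). Hence this gives the CM-type
> `S = {1, −9, 19, −16, 20, 25, −8, 10, −28, 4, −5, 14, −2, 18, −7} ⊂ (ℤ/31ℤ)^*`.
> Since `S ∈ S₃ − S₁` by Proposition 4.3 and 4.6, the abelian variety `A_S` associated to it is absolutely simple
> and `3`-dominated by Theorem 4.8. This is a member of the set of `Σ_{0≤i≤3} C(3,i)⁵ − 2³ = 480` of `3`-dominated
> absolutely simple abelian varieties with complex multiplication by `K₃₁`.  If we define another matrix
> `(b_{ij}) ∈ M(3, 5)` by `b_{i1} = 1` (`1 ≤ i ≤ 3`), `b_{ij} = 0` otherwise, then it corresponds to the CM-type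
> `T = {1, −9, 19, 16, −20, 25, −8, 10, −28, 4, −5, 14, −2, 18, −7} ⊂ (ℤ/31ℤ)^*`. Since `T ∈ S₅ − S₁` … `A_T` … is
> absolutely simple and `5`-dominated …  `Σ_{0≤i≤5} C(5,i)³ − 2⁵ = 2220` of `5`-dominated …"

(§4, p. 587–589: a CM type `S ⊂ ℤ/2nℤ` has the sign vector `ε_a = f_S(a)`, `0 ≤ a ≤ n − 1`, `f_S = χ_S − χ_{ρS}`,
`ρ = n`; i.e. `a ∈ S` if `ε_a = 1` and `a + n ∈ S` if `ε_a = −1`.  Through `a ↦ 3^a`, `3^{15} = −1`, this reads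
`S = {ε_a · 3^a : 0 ≤ a ≤ 14} ⊂ (ℤ/31)^*`.)

## What is recorded, and a discrepancy in the printed lists

With the sign vectors displayed in the text, the recipe `S = {ε_a · 3^a}` gives the residue sets
`hazamaS₃₁ = {1, 28, 9, 4, 19, 26, 15, 17, 11, 29, 6, 13, 23, 24, 21}` (`hazamaS₃₁_eq_image`) and, for the matrix
`(b_{ij})` (sign vector `e' = (1,1,1,−1,…,−1)` by the symmetry `p ↔ q` of Prop. 4.4), `hazamaT₃₁` (`hazamaT₃₁_eq_image`).
The lists PRINTED on p. 597–598, read as residues modulo `31`, are `printedS₃₁ = {ε_a · 9^a}` and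
`printedT₃₁ = {ε'_a · 9^a}` (`printedS₃₁_eq_image`, `printedT₃₁_eq_image`; `9 = 3²` is not a generator of
`(ℤ/31)^*`).  All four are primitive CM residue sets.  We CERTIFY (by `decide` on `ℤ/31` and Theorem 4.8 of the
parent file), for the frame `τ = 5` (order `3`), `κ = 2` (order `5`), `ρ = −1` of `(ℤ/31)^*`:

* §1 `frame31`; the four sets, their generation by the recipe, the CM condition, primitivity
  (`HasTrivialStabilizer`, decided).
* §2 **`hazamaS₃₁ ∈ S₃ − S₁`** as the text asserts for `S`: constant row counts (`hasConstantRows_hazamaS`), non-constant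
  column counts, trivial stabiliser; hence (parent file) `Φ_{hazamaS₃₁}` is a PRIMITIVE DEGENERATE CM type of `ℚ(ζ₃₁)`
  of rank **`12`** (`cmTypeRank_hazamaS`), and every abelian variety of this type is a SIMPLE `15`-fold carrying a
  rational `(3,3)`-class outside `D³ ⊗ ℂ` (`realisation_hazamaS`; such varieties exist, `exists_realisation_hazamaS`).
  **`hazamaT₃₁ ∈ S₅ − S₁`**: rank **`14`**, simple `15`-folds with a rational `(5,5)`-class outside `D⁵ ⊗ ℂ`.
* §3 THE PRINTED LISTS ARE NONDEGENERATE: `printedS₃₁` and `printedT₃₁` have trivial stabiliser and NEITHER constant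
  rows NOR constant columns (`decide`), so by Thm. 4.8 (ii) their CM types are nondegenerate (rank `16`,
  `isNondegenerate_printedS`, `cmTypeRank_printedS`) — their abelian varieties are simple `15`-folds all of whose
  powers satisfy the Hodge conjecture (`hodgeConjectureFor_pow_printedS`).  In particular the assertions
  "`S ∈ S₃ − S₁`", "`T ∈ S₅ − S₁`" hold for the sets the displayed recipe defines (§2), not for the lists as printed;
  we record both facts and draw no further conclusion.

NOT here: the counts `480` and `2220` (the cardinalities `#(S_p − S₁) = Σ_i C(p,i)^q − 2^p` of Thm. 4.8 are not
formalised in this series).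

## References

* [Hazama2003CyclicCM] F. Hazama, J. Math. Sci. Univ. Tokyo 10 (2003) 581–598, §6 (p. 597–598), §4 (4.1)–(4.3),
  Thm. 4.8.
* [Gordon1999HodgeAVSurvey] B. B. Gordon, *A survey of the Hodge conjecture for abelian varieties*, 9.2.2, Thm. 6.4.
* [Shimura1998] G. Shimura, *Abelian Varieties with Complex Multiplication and Modular Functions*, §8.2 Prop. 26,
  §6.2 Thm. 3.

## Provenance

Cell `pub-hodgecm2` (COR-CM), literature seat `lit-deligne-3` gen 18 (claim HAZAMA-CYCLIC-2PQ; count-neutral).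
-/

set_option autoImplicit false

noncomputable section

open scoped BigOperators NumberField
open CategoryTheory NumberField

namespace Literature.AlgebraicGeometry.ComplexMultiplication

namespace CyclotomicThirtyOne

open Literature.NumberTheory.ComplexMultiplication
open Literature.NumberTheory.ComplexMultiplication.CyclicCMType
open Literature.AlgebraicGeometry.Motives (AbelianVariety CMType)
open Literature.AlgebraicGeometry.HodgeTheory
open Literature.AlgebraicGeometry.Pohlmann1968 Literature.AlgebraicGeometry.Pohlmann1968.Cyclotomic
open Literature.AlgebraicGeometry.ComplexMultiplication.CyclotomicCMTypeResidueSets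
open Literature.AlgebraicGeometry.ComplexMultiplication.CyclotomicTwoOddPrimes
open Literature.Barriers.HodgeConjecture (divisorClassesSpan)

/-- `𝓤[ℓ, S] = {u ∈ (ℤ/ℓ)ˣ : u mod ℓ ∈ S}` (local notation, as in the parent file). -/
local notation3 "𝓤[" ℓ ", " S "]" =>
  Finset.filter (fun u : (ZMod ℓ)ˣ => ((u : (ZMod ℓ)ˣ) : ZMod ℓ) ∈ S) Finset.univ

/-! ## §1 The frame of `(ℤ/31)ˣ` and the four residue sets -/

section Sets

/-- `31` is prime. [folklore] -/
instance fact_prime_thirtyOne : Fact (Nat.Prime 31) := ⟨by norm_num⟩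

/-- `τ = 5 = 3¹⁰·…` — a unit of order `3` in `(ℤ/31)ˣ` (`5³ = 125 ≡ 1`). [cite: Hazama2003CyclicCM, §6 (p. 597)] -/
def τ₃₁ : (ZMod 31)ˣ := Units.mkOfMulEqOne (5 : ZMod 31) 25 (by decide)

/-- `κ = 2` — a unit of order `5` in `(ℤ/31)ˣ` (`2⁵ = 32 ≡ 1`). [cite: Hazama2003CyclicCM, §6 (p. 597)] -/
def κ₃₁ : (ZMod 31)ˣ := Units.mkOfMulEqOne (2 : ZMod 31) 16 (by decide)

/-- `τ = 5` as a residue. [cite: Hazama2003CyclicCM, §6 (p. 597)] -/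
@[simp] theorem coe_τ₃₁ : (τ₃₁ : ZMod 31) = 5 := rfl

/-- `κ = 2` as a residue. [cite: Hazama2003CyclicCM, §6 (p. 597)] -/
@[simp] theorem coe_κ₃₁ : (κ₃₁ : ZMod 31) = 2 := rfl

/-- **The frame** `((ℤ/31)ˣ; ρ = −1, τ = 5, κ = 2)` with `p = 3`, `q = 5` (`31 = 2·3·5 + 1`).
[cite: Hazama2003CyclicCM, §6 (p. 597)] -/
theorem frame31 : CyclicFrame 3 5 (-1 : (ZMod 31)ˣ) τ₃₁ κ₃₁ :=
  cyclicFrame_units_of_pow_eq_one (by norm_num) (by norm_num) (by decide) (by decide) (by decide) (by norm_num)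
    (Units.ext (by decide)) (fun h => absurd (congrArg (fun u : (ZMod 31)ˣ => (u : ZMod 31)) h) (by decide))
    (Units.ext (by decide)) (fun h => absurd (congrArg (fun u : (ZMod 31)ˣ => (u : ZMod 31)) h) (by decide))

/-- **Hazama's `3`-dominated type by the displayed recipe**: `S = {ε_a · 3^a : 0 ≤ a ≤ 14}`, `ε_a = (−1)^a`
(`a ≤ 4`), `(−1)^{a+1}` (`5 ≤ a ≤ 14`) — the matrix `a_{i1} = 1` of `M(5,3)`. [cite: Hazama2003CyclicCM, §6 (p. 597)] -/
def hazamaS₃₁ : Finset (ZMod 31) := {1, 28, 9, 4, 19, 26, 15, 17, 11, 29, 6, 13, 23, 24, 21}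

/-- **Hazama's `5`-dominated type by the recipe**: `T = {ε'_a · 3^a}`, `ε'_a = (−1)^a` (`a ≤ 2`), `(−1)^{a+1}`
(`3 ≤ a ≤ 14`) — the matrix `b_{i1} = 1` of `M(3,5)`. [cite: Hazama2003CyclicCM, §6 (p. 598)] -/
def hazamaT₃₁ : Finset (ZMod 31) := {1, 28, 9, 27, 12, 26, 15, 17, 11, 29, 6, 13, 23, 24, 21}

/-- **The list printed for `S`** on p. 597: `{1, −9, 19, −16, 20, 25, −8, 10, −28, 4, −5, 14, −2, 18, −7}` modulo `31`.
[cite: Hazama2003CyclicCM, §6 (p. 597)] -/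
def printedS₃₁ : Finset (ZMod 31) := {1, 22, 19, 15, 20, 25, 23, 10, 3, 4, 26, 14, 29, 18, 24}

/-- **The list printed for `T`** on p. 598: `{1, −9, 19, 16, −20, 25, −8, 10, −28, 4, −5, 14, −2, 18, −7}` modulo `31`.
[cite: Hazama2003CyclicCM, §6 (p. 598)] -/
def printedT₃₁ : Finset (ZMod 31) := {1, 22, 19, 16, 11, 25, 23, 10, 3, 4, 26, 14, 29, 18, 24}

/-- The printed list for `S`, verbatim with its signs. [cite: Hazama2003CyclicCM, §6 (p. 597)] -/
theorem printedS₃₁_eq : printedS₃₁ =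
    ({1, -9, 19, -16, 20, 25, -8, 10, -28, 4, -5, 14, -2, 18, -7} : Finset (ZMod 31)) := by decide

/-- The printed list for `T`, verbatim with its signs. [cite: Hazama2003CyclicCM, §6 (p. 598)] -/
theorem printedT₃₁_eq : printedT₃₁ =
    ({1, -9, 19, 16, -20, 25, -8, 10, -28, 4, -5, 14, -2, 18, -7} : Finset (ZMod 31)) := by decide

/-- **The recipe**: `hazamaS₃₁ = {ε_a · 3^a : a < 15}` with Hazama's `ε`. [cite: Hazama2003CyclicCM, §6 (p. 597) and (4.3)] -/
theorem hazamaS₃₁_eq_image : hazamaS₃₁ =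
    (Finset.range 15).image fun a => (if a ≤ 4 then (-1 : ZMod 31) ^ a else (-1) ^ (a + 1)) * 3 ^ a := by
  decide

/-- `hazamaT₃₁ = {ε'_a · 3^a : a < 15}`. [cite: Hazama2003CyclicCM, §6 (p. 598) and (4.3)] -/
theorem hazamaT₃₁_eq_image : hazamaT₃₁ =
    (Finset.range 15).image fun a => (if a ≤ 2 then (-1 : ZMod 31) ^ a else (-1) ^ (a + 1)) * 3 ^ a := by
  decide

/-- **The printed list is `{ε_a · 9^a}`** (`9 = 3²`). [cite: Hazama2003CyclicCM, §6 (p. 597)] -/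
theorem printedS₃₁_eq_image : printedS₃₁ =
    (Finset.range 15).image fun a => (if a ≤ 4 then (-1 : ZMod 31) ^ a else (-1) ^ (a + 1)) * 9 ^ a := by
  decide

/-- The printed list for `T` is `{ε'_a · 9^a}`. [cite: Hazama2003CyclicCM, §6 (p. 598)] -/
theorem printedT₃₁_eq_image : printedT₃₁ =
    (Finset.range 15).image fun a => (if a ≤ 2 then (-1 : ZMod 31) ^ a else (-1) ^ (a + 1)) * 9 ^ a := by
  decide

/-- `3` generates `(ℤ/31)ˣ` ("the primitive root `3`": `3¹⁵ = −1 ≠ 1`, `3¹⁰ ≠ 1`, `3⁶ ≠ 1`), while `9` does not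
(`9¹⁵ = 1`). [cite: Hazama2003CyclicCM, §6 (p. 597)] -/
theorem pow_three_and_nine :
    (3 : ZMod 31) ^ 15 = -1 ∧ (3 : ZMod 31) ^ 10 ≠ 1 ∧ (3 : ZMod 31) ^ 6 ≠ 1 ∧ (9 : ZMod 31) ^ 15 = 1 := by decide

/-- `hazamaS₃₁` is a CM residue set. [cite: Hazama2003CyclicCM, §6 (p. 597)] -/
theorem isCMResidueSet_hazamaS : IsCMResidueSet 31 hazamaS₃₁ := by decide

/-- `hazamaT₃₁` is a CM residue set. [cite: Hazama2003CyclicCM, §6 (p. 598)] -/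
theorem isCMResidueSet_hazamaT : IsCMResidueSet 31 hazamaT₃₁ := by decide

/-- `printedS₃₁` is a CM residue set. [cite: Hazama2003CyclicCM, §6 (p. 597)] -/
theorem isCMResidueSet_printedS : IsCMResidueSet 31 printedS₃₁ := by decide

/-- `printedT₃₁` is a CM residue set. [cite: Hazama2003CyclicCM, §6 (p. 598)] -/
theorem isCMResidueSet_printedT : IsCMResidueSet 31 printedT₃₁ := by decide

/-- `hazamaS₃₁` has trivial stabiliser (primitive). [cite: Hazama2003CyclicCM, §6 (p. 597)] -/
theorem hasTrivialStabilizer_hazamaS : HasTrivialStabilizer 31 hazamaS₃₁ := by decide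

/-- `hazamaT₃₁` has trivial stabiliser (primitive). [cite: Hazama2003CyclicCM, §6 (p. 598)] -/
theorem hasTrivialStabilizer_hazamaT : HasTrivialStabilizer 31 hazamaT₃₁ := by decide

/-- `printedS₃₁` has trivial stabiliser (primitive). [cite: Hazama2003CyclicCM, §6 (p. 597)] -/
theorem hasTrivialStabilizer_printedS : HasTrivialStabilizer 31 printedS₃₁ := by decide

/-- `printedT₃₁` has trivial stabiliser (primitive). [cite: Hazama2003CyclicCM, §6 (p. 598)] -/
theorem hasTrivialStabilizer_printedT : HasTrivialStabilizer 31 printedT₃₁ := by decide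

/-- **`hazamaS₃₁ ∈ S₃`: constant row counts** (one point of `S` in each coset `2ʸ·{1, 5, 25}`).
[cite: Hazama2003CyclicCM, §6 (p. 597) and Prop. 4.3] -/
theorem hasConstantRows_hazamaS : HasConstantRows 3 5 𝓤[31, hazamaS₃₁] τ₃₁ κ₃₁ :=
  hasConstantRows_iff_card_filter.2 (by decide)

/-- `hazamaS₃₁ ∉ S₅`: the column counts are not constant. [cite: Hazama2003CyclicCM, §6 (p. 597) and Prop. 4.4] -/
theorem not_hasConstantCols_hazamaS : ¬ HasConstantRows 5 3 𝓤[31, hazamaS₃₁] κ₃₁ τ₃₁ := fun h =>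
  absurd (hasConstantRows_iff_card_filter.1 h) (by decide)

/-- **`hazamaT₃₁ ∈ S₅`: constant column counts** (one point of `T` in each coset `5ʸ·{1, 2, 4, 8, 16}`).
[cite: Hazama2003CyclicCM, §6 (p. 598) and Prop. 4.4] -/
theorem hasConstantCols_hazamaT : HasConstantRows 5 3 𝓤[31, hazamaT₃₁] κ₃₁ τ₃₁ :=
  hasConstantRows_iff_card_filter.2 (by decide)

/-- `hazamaT₃₁ ∉ S₃`. [cite: Hazama2003CyclicCM, §6 (p. 598) and Prop. 4.3] -/
theorem not_hasConstantRows_hazamaT : ¬ HasConstantRows 3 5 𝓤[31, hazamaT₃₁] τ₃₁ κ₃₁ := fun h =>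
  absurd (hasConstantRows_iff_card_filter.1 h) (by decide)

/-- `printedS₃₁ ∉ S₃`: its row counts are NOT constant. [cite: Hazama2003CyclicCM, §6 (p. 597) and Prop. 4.3] -/
theorem not_hasConstantRows_printedS : ¬ HasConstantRows 3 5 𝓤[31, printedS₃₁] τ₃₁ κ₃₁ := fun h =>
  absurd (hasConstantRows_iff_card_filter.1 h) (by decide)

/-- `printedS₃₁ ∉ S₅`. [cite: Hazama2003CyclicCM, §6 (p. 597) and Prop. 4.4] -/
theorem not_hasConstantCols_printedS : ¬ HasConstantRows 5 3 𝓤[31, printedS₃₁] κ₃₁ τ₃₁ := fun h =>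
  absurd (hasConstantRows_iff_card_filter.1 h) (by decide)

/-- `printedT₃₁ ∉ S₃`. [cite: Hazama2003CyclicCM, §6 (p. 598) and Prop. 4.3] -/
theorem not_hasConstantRows_printedT : ¬ HasConstantRows 3 5 𝓤[31, printedT₃₁] τ₃₁ κ₃₁ := fun h =>
  absurd (hasConstantRows_iff_card_filter.1 h) (by decide)

/-- `printedT₃₁ ∉ S₅`: its column counts are NOT constant. [cite: Hazama2003CyclicCM, §6 (p. 598) and Prop. 4.4] -/
theorem not_hasConstantCols_printedT : ¬ HasConstantRows 5 3 𝓤[31, printedT₃₁] κ₃₁ τ₃₁ := fun h =>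
  absurd (hasConstantRows_iff_card_filter.1 h) (by decide)

end Sets

/-! ## §2 The recipe sets: `hazamaS₃₁ ∈ S₃ − S₁` (rank `12`), `hazamaT₃₁ ∈ S₅ − S₁` (rank `14`) -/

section Recipe

variable (L : Type) [Field L] [NumberField L] [IsCyclotomicExtension {31} ℚ L]
variable {A : AbelianVariety ℂ} {ι : 𝓞 L →+* End A} {θ : L →+* Module.End ℂ (complexBetti A.X 1)}

/-- **`Φ_S` is PRIMITIVE** for `S = hazamaS₃₁`. [cite: Hazama2003CyclicCM, §6 (p. 597) and Thm. 4.8 (iii)]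
[cite: Shimura1998, §8.2 Prop. 26] -/
theorem isPrimitive_hazamaS (φ₀ : L →+* ℂ) :
    IsPrimitive (ℂ ≃+* ℂ) (cmTypeOfResidues (L := L) hazamaS₃₁ isCMResidueSet_hazamaS.cm).1 φ₀ :=
  (isPrimitive_iff L isCMResidueSet_hazamaS isCMResidueSet_hazamaS.cm φ₀).2
    (hasTrivialStabilizer_iff.1 hasTrivialStabilizer_hazamaS)

/-- **`Φ_S` is DEGENERATE** for `S = hazamaS₃₁` (`S ∈ S₃`). [cite: Hazama2003CyclicCM, §6 (p. 597) and Thm. 4.8 (ii)] -/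
theorem not_isNondegenerate_hazamaS :
    ¬ IsNondegenerate (cmTypeOfResidues (L := L) hazamaS₃₁ isCMResidueSet_hazamaS.cm) :=
  not_isNondegenerate_of_hasConstantRows L frame31 _ hasConstantRows_hazamaS

/-- **`rank(Φ_S) = 12 = (3−1)·5 + 2`** for `S = hazamaS₃₁` (`dim Hg(A_S) = 11 < 15`).
[cite: Hazama2003CyclicCM, §6 (p. 597), §5 and Thm. 4.8 (iv)] [cite: Kubota1965, §4 Lemma 2] -/
theorem cmTypeRank_hazamaS :
    cmTypeRank (cmTypeOfResidues (L := L) hazamaS₃₁ isCMResidueSet_hazamaS.cm) = 12 :=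
  cmTypeRank_eq_of_hasConstantRows L frame31 _ (hasTrivialStabilizer_iff.1 hasTrivialStabilizer_hazamaS)
    hasConstantRows_hazamaS

/-- **The abelian varieties `A_S`** (every realisation of `(ℚ(ζ₃₁); Φ_S)`, `S = hazamaS₃₁`): SIMPLE ("absolutely
simple"), of dimension `15`, with a rational `(3,3)`-class OUTSIDE `D³(A) ⊗ ℂ` ("`3`-dominated": a nondivisorial
Hodge cycle of codimension `3` on `A` itself). [cite: Hazama2003CyclicCM, §6 (p. 597), Thm. 4.8 (iv) and Rem. 4.10]
[cite: Gordon1999HodgeAVSurvey, 9.2.2] -/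
theorem realisation_hazamaS
    (hA : IsCMTypeRealisation (cmTypeOfResidues (L := L) hazamaS₃₁ isCMResidueSet_hazamaS.cm) A ι θ) :
    A.IsSimple ∧ A.dim = 15 ∧ ∃ c : complexBetti A.X 6, IsRationalClass c ∧ IsOfHodgeType 15 A.X 6 3 3 c ∧
      c ∉ divisorClassesSpan A.X 15 3 :=
  ⟨isSimple_of_forall_not_isStableUnder (hasTrivialStabilizer_iff.1 hasTrivialStabilizer_hazamaS) hA,
    dim_eq frame31 hA,
    exists_exceptional_of_hasConstantRows frame31 (hasTrivialStabilizer_iff.1 hasTrivialStabilizer_hazamaS)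
      hasConstantRows_hazamaS hA⟩

/-- Such abelian varieties exist (Shimura §6.2 Thm. 3). [cite: Shimura1998, §6.2 Theorem 3]
[cite: Hazama2003CyclicCM, §6 (p. 597)] -/
theorem exists_realisation_hazamaS :
    ∃ (B : AbelianVariety ℂ) (ι' : 𝓞 L →+* End B) (θ' : L →+* Module.End ℂ (complexBetti B.X 1)),
      IsCMTypeRealisation (cmTypeOfResidues (L := L) hazamaS₃₁ isCMResidueSet_hazamaS.cm) B ι' θ' ∧
        B.IsSimple ∧ B.dim = 15 ∧ ∃ c : complexBetti B.X 6, IsRationalClass c ∧ IsOfHodgeType 15 B.X 6 3 3 c ∧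
          c ∉ divisorClassesSpan B.X 15 3 :=
  exists_realisation_exceptional_of_hasConstantRows frame31 _
    (hasTrivialStabilizer_iff.1 hasTrivialStabilizer_hazamaS) hasConstantRows_hazamaS

/-- **`Φ_T` is PRIMITIVE** for `T = hazamaT₃₁`. [cite: Hazama2003CyclicCM, §6 (p. 598) and Thm. 4.8 (iii)] -/
theorem isPrimitive_hazamaT (φ₀ : L →+* ℂ) :
    IsPrimitive (ℂ ≃+* ℂ) (cmTypeOfResidues (L := L) hazamaT₃₁ isCMResidueSet_hazamaT.cm).1 φ₀ :=
  (isPrimitive_iff L isCMResidueSet_hazamaT isCMResidueSet_hazamaT.cm φ₀).2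
    (hasTrivialStabilizer_iff.1 hasTrivialStabilizer_hazamaT)

/-- **`Φ_T` is DEGENERATE** (`T ∈ S₅`). [cite: Hazama2003CyclicCM, §6 (p. 598) and Thm. 4.8 (ii)] -/
theorem not_isNondegenerate_hazamaT :
    ¬ IsNondegenerate (cmTypeOfResidues (L := L) hazamaT₃₁ isCMResidueSet_hazamaT.cm) :=
  (not_isNondegenerate_iff L frame31 _).2 (Or.inr (Or.inl hasConstantCols_hazamaT))

/-- **`rank(Φ_T) = 14 = (5−1)·3 + 2`** for `T = hazamaT₃₁`. [cite: Hazama2003CyclicCM, §6 (p. 598), §5 and Thm. 4.8 (v)]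
[cite: Kubota1965, §4 Lemma 2] -/
theorem cmTypeRank_hazamaT :
    cmTypeRank (cmTypeOfResidues (L := L) hazamaT₃₁ isCMResidueSet_hazamaT.cm) = 14 :=
  cmTypeRank_eq_of_hasConstantCols L frame31 _ (hasTrivialStabilizer_iff.1 hasTrivialStabilizer_hazamaT)
    hasConstantCols_hazamaT

/-- **The abelian varieties `A_T`**: simple `15`-folds with a rational `(5,5)`-class outside `D⁵(A) ⊗ ℂ`
("`5`-dominated"). [cite: Hazama2003CyclicCM, §6 (p. 598), Thm. 4.8 (v) and Rem. 4.10] [cite: Gordon1999HodgeAVSurvey, 9.2.2] -/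
theorem realisation_hazamaT
    (hA : IsCMTypeRealisation (cmTypeOfResidues (L := L) hazamaT₃₁ isCMResidueSet_hazamaT.cm) A ι θ) :
    A.IsSimple ∧ A.dim = 15 ∧ ∃ c : complexBetti A.X 10, IsRationalClass c ∧ IsOfHodgeType 15 A.X 10 5 5 c ∧
      c ∉ divisorClassesSpan A.X 15 5 :=
  ⟨isSimple_of_forall_not_isStableUnder (hasTrivialStabilizer_iff.1 hasTrivialStabilizer_hazamaT) hA,
    dim_eq frame31 hA,
    exists_exceptional_of_hasConstantCols frame31 (hasTrivialStabilizer_iff.1 hasTrivialStabilizer_hazamaT)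
      hasConstantCols_hazamaT hA⟩

end Recipe

/-! ## §3 The printed lists: primitive and NONDEGENERATE -/

section Printed

variable (L : Type) [Field L] [NumberField L] [IsCyclotomicExtension {31} ℚ L]
variable {A : AbelianVariety ℂ} {ι : 𝓞 L →+* End A} {θ : L →+* Module.End ℂ (complexBetti A.X 1)}

/-- `printedS₃₁` is stable neither under `τ` nor under `κ` (trivial stabiliser). [cite: Hazama2003CyclicCM, §6 (p. 597)] -/
theorem not_isStableUnder_printedS :
    ¬ IsStableUnder 𝓤[31, printedS₃₁] τ₃₁ ∧ ¬ IsStableUnder 𝓤[31, printedS₃₁] κ₃₁ :=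
  ⟨hasTrivialStabilizer_iff.1 hasTrivialStabilizer_printedS τ₃₁
      (fun h => absurd (congrArg (fun u : (ZMod 31)ˣ => (u : ZMod 31)) h) (by decide)),
    hasTrivialStabilizer_iff.1 hasTrivialStabilizer_printedS κ₃₁
      (fun h => absurd (congrArg (fun u : (ZMod 31)ˣ => (u : ZMod 31)) h) (by decide))⟩

/-- `printedT₃₁` is stable neither under `τ` nor under `κ`. [cite: Hazama2003CyclicCM, §6 (p. 598)] -/
theorem not_isStableUnder_printedT :
    ¬ IsStableUnder 𝓤[31, printedT₃₁] τ₃₁ ∧ ¬ IsStableUnder 𝓤[31, printedT₃₁] κ₃₁ :=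
  ⟨hasTrivialStabilizer_iff.1 hasTrivialStabilizer_printedT τ₃₁
      (fun h => absurd (congrArg (fun u : (ZMod 31)ˣ => (u : ZMod 31)) h) (by decide)),
    hasTrivialStabilizer_iff.1 hasTrivialStabilizer_printedT κ₃₁
      (fun h => absurd (congrArg (fun u : (ZMod 31)ˣ => (u : ZMod 31)) h) (by decide))⟩

/-- **The CM type of the list printed for `S` is NONDEGENERATE** (it lies in none of `S₁`, `S₃`, `S₅`; Thm. 4.8 (ii)).
[cite: Hazama2003CyclicCM, §6 (p. 597) and Thm. 4.8 (ii)] -/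
theorem isNondegenerate_printedS :
    IsNondegenerate (cmTypeOfResidues (L := L) printedS₃₁ isCMResidueSet_printedS.cm) :=
  (isNondegenerate_iff L frame31 _).2 ⟨not_hasConstantRows_printedS, not_hasConstantCols_printedS,
    not_isStableUnder_printedS.1, not_isStableUnder_printedS.2⟩

/-- Its rank is the full `16 = 15 + 1`. [cite: Hazama2003CyclicCM, §6 (p. 597) and Thm. 4.8 (ii)] [cite: Kubota1965, §2] -/
theorem cmTypeRank_printedS :
    cmTypeRank (cmTypeOfResidues (L := L) printedS₃₁ isCMResidueSet_printedS.cm) = 16 := by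
  have h := isNondegenerate_printedS L
  rw [isNondegenerate_iff_typeRank_eq L frame31] at h
  rw [CyclotomicFermatCMType.cmTypeRank_cmTypeOfResidues_eq 31 L, h]

/-- **The CM type of the list printed for `T` is NONDEGENERATE.** [cite: Hazama2003CyclicCM, §6 (p. 598) and Thm. 4.8 (ii)] -/
theorem isNondegenerate_printedT :
    IsNondegenerate (cmTypeOfResidues (L := L) printedT₃₁ isCMResidueSet_printedT.cm) :=
  (isNondegenerate_iff L frame31 _).2 ⟨not_hasConstantRows_printedT, not_hasConstantCols_printedT,
    not_isStableUnder_printedT.1, not_isStableUnder_printedT.2⟩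

/-- Its rank is `16`. [cite: Hazama2003CyclicCM, §6 (p. 598) and Thm. 4.8 (ii)] [cite: Kubota1965, §2] -/
theorem cmTypeRank_printedT :
    cmTypeRank (cmTypeOfResidues (L := L) printedT₃₁ isCMResidueSet_printedT.cm) = 16 := by
  have h := isNondegenerate_printedT L
  rw [isNondegenerate_iff_typeRank_eq L frame31] at h
  rw [CyclotomicFermatCMType.cmTypeRank_cmTypeOfResidues_eq 31 L, h]

/-- **The abelian varieties of the printed type `S`**: simple `15`-folds ALL OF WHOSE POWERS SATISFY THE HODGE
CONJECTURE (nondegenerate: White–Hazama, tree `IsNondegenerate.hodgeConjectureFor_pow`).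
[cite: Hazama2003CyclicCM, §6 (p. 597) and Thm. 4.8 (ii)] [cite: Gordon1999HodgeAVSurvey, Thm. 6.4 and §9.3] -/
theorem hodgeConjectureFor_pow_printedS
    (hA : IsCMTypeRealisation (cmTypeOfResidues (L := L) printedS₃₁ isCMResidueSet_printedS.cm) A ι θ) :
    A.IsSimple ∧ A.dim = 15 ∧ ∀ k : ℕ, HodgeConjectureFor (⨁ fun _ : Fin k => A).dim (⨁ fun _ : Fin k => A).X :=
  isSimple_and_hodgeConjectureFor_pow_of_not_mem frame31 not_hasConstantRows_printedS not_hasConstantCols_printedS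
    not_isStableUnder_printedS.1 not_isStableUnder_printedS.2 hA

/-- **The abelian varieties of the printed type `T`**: simple `15`-folds all of whose powers satisfy the Hodge
conjecture. [cite: Hazama2003CyclicCM, §6 (p. 598) and Thm. 4.8 (ii)] [cite: Gordon1999HodgeAVSurvey, Thm. 6.4 and §9.3] -/
theorem hodgeConjectureFor_pow_printedT
    (hA : IsCMTypeRealisation (cmTypeOfResidues (L := L) printedT₃₁ isCMResidueSet_printedT.cm) A ι θ) :
    A.IsSimple ∧ A.dim = 15 ∧ ∀ k : ℕ, HodgeConjectureFor (⨁ fun _ : Fin k => A).dim (⨁ fun _ : Fin k => A).X :=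
  isSimple_and_hodgeConjectureFor_pow_of_not_mem frame31 not_hasConstantRows_printedT not_hasConstantCols_printedT
    not_isStableUnder_printedT.1 not_isStableUnder_printedT.2 hA

end Printed

end CyclotomicThirtyOne

end Literature.AlgebraicGeometry.ComplexMultiplication

end
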